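import Summits.ResolutionOfSingularities.ResolutionOfSingularities.Theorems.FrobeniusLadderFRationalResolutionFRationalSurfaceAnStalks
import Summits.ResolutionOfSingularities.ResolutionOfSingularities.Theorems.FrobeniusLadderFRationalResolutionResolutionRestrict
import Summits.ResolutionOfSingularities.ResolutionOfSingularities.Theorems.FrobeniusLadderFRationalResolutionAnResolutionStep
import HarnessLib

/-!
# (G2) for `A_n` germs, stated on stalks: a local resolution at an `A_n` singular point

Support file for crux stmt-ResolutionOfSingularities-15317 (`FrobeniusLadder.FRationalResolution`),
line `Sketch`, continuation seat c3, cycle 10 (closure of theme REC). Extracts the per-point content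
of the intrinsic showcase (`hasResolution_fRational_surface_of_An_stalks`, p160375) as the ONE-GERM
statement (G2) of `fRationalResolution_surfaces_of_two_germ_problems` (p157513) for `A_n` germs
given on STALKS: recognition (`exists_isOpenImmersion_nhd_of_stalk_iso`, p159158) produces a
Zariski chart `j : U → A_n`, the regular loci correspond, and the tower model of `A_n`
(`An_offOrigin_resolution`, p148196) restricts along `j` (`stub_offLocus_resolution_restrict`,
p149210). [folklore; Kollár 2007 §2.2, Lipman 1978 §2]
-/

-- single-problem summit: the doubled namespace component is forced
set_option linter.dupNamespace false

noncomputable section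

namespace Summit.ResolutionOfSingularities.ResolutionOfSingularities.Theorems.FRationalResolution

open CategoryTheory AlgebraicGeometry TopologicalSpace MvPolynomial
open Literature.AlgebraicGeometry.Resolution

variable (k : Type) [Field k]

local notation3 "gA[" n "]" => (X (Sum.inl 0) * X (Sum.inl 1) + rename Sum.inr (X 0 ^ (n + 1)) :
  MvPolynomial (Fin 2 ⊕ Fin 1) k)
local notation3 "RA[" n "]" => MvPolynomial (Fin 2 ⊕ Fin 1) k ⧸ Ideal.span {gA[n]}
local notation3 "mkA[" n "]" => Ideal.Quotient.mk (Ideal.span {gA[n]})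

/-- **(G2) FOR `A_n` GERMS, STATED ON STALKS.** Let `X` be an integral `k`-scheme locally of finite
type and `s` a singular point whose local ring is `k`-isomorphic to the local ring of
`A_n = Spec k[y,z,x]/(yz + x^(n+1))` at its origin (compatibly with the structure maps). Then `s`
has an open neighbourhood `V`, containing no other singular point, with a LOCAL RESOLUTION: a
proper `ρ : Y → V` with `Y` regular, an isomorphism over `V ∩ Reg X` with dense preimage (the
tower model of `A_n`, restricted along the Zariski chart produced by recognition). This is the
one-germ statement (G2) of `fRationalResolution_surfaces_of_two_germ_problems` for `A_n` germs.
[folklore; Kollár 2007 §2.2, Lipman 1978 §2] -/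
theorem local_resolution_of_An_stalk (X : Scheme.{0}) [IsIntegral X] (f : X ⟶ Spec (.of k))
    [LocallyOfFiniteType f] (s : X) (hs : s ∉ Scheme.regularLocus X) (n : ℕ)
    (q : Spec (CommRingCat.of (MvPolynomial (Fin 2 ⊕ Fin 1) k ⧸ Ideal.span
      {(MvPolynomial.X (Sum.inl 0) * MvPolynomial.X (Sum.inl 1) +
        MvPolynomial.rename Sum.inr (MvPolynomial.X 0 ^ (n + 1)) : MvPolynomial (Fin 2 ⊕ Fin 1) k)})))
    (hq : Ideal.Quotient.mk (Ideal.span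
      {(MvPolynomial.X (Sum.inl 0) * MvPolynomial.X (Sum.inl 1) +
        MvPolynomial.rename Sum.inr (MvPolynomial.X 0 ^ (n + 1)) : MvPolynomial (Fin 2 ⊕ Fin 1) k)}) (MvPolynomial.X (Sum.inl 0)) ∈ q.asIdeal ∧
      Ideal.Quotient.mk (Ideal.span
      {(MvPolynomial.X (Sum.inl 0) * MvPolynomial.X (Sum.inl 1) +
        MvPolynomial.rename Sum.inr (MvPolynomial.X 0 ^ (n + 1)) : MvPolynomial (Fin 2 ⊕ Fin 1) k)}) (MvPolynomial.X (Sum.inl 1)) ∈ q.asIdeal ∧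
      Ideal.Quotient.mk (Ideal.span
      {(MvPolynomial.X (Sum.inl 0) * MvPolynomial.X (Sum.inl 1) +
        MvPolynomial.rename Sum.inr (MvPolynomial.X 0 ^ (n + 1)) : MvPolynomial (Fin 2 ⊕ Fin 1) k)}) (MvPolynomial.X (Sum.inr 0)) ∈ q.asIdeal)
    (e : (Spec (CommRingCat.of (MvPolynomial (Fin 2 ⊕ Fin 1) k ⧸ Ideal.span
      {(MvPolynomial.X (Sum.inl 0) * MvPolynomial.X (Sum.inl 1) +
        MvPolynomial.rename Sum.inr (MvPolynomial.X 0 ^ (n + 1)) : MvPolynomial (Fin 2 ⊕ Fin 1) k)}))).presheaf.stalk q ≅ X.presheaf.stalk s)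
    (he : Spec.map e.hom ≫ (Spec (CommRingCat.of (MvPolynomial (Fin 2 ⊕ Fin 1) k ⧸ Ideal.span
      {(MvPolynomial.X (Sum.inl 0) * MvPolynomial.X (Sum.inl 1) +
        MvPolynomial.rename Sum.inr (MvPolynomial.X 0 ^ (n + 1)) : MvPolynomial (Fin 2 ⊕ Fin 1) k)}))).fromSpecStalk q ≫
      Spec.map (CommRingCat.ofHom (algebraMap k (MvPolynomial (Fin 2 ⊕ Fin 1) k ⧸ Ideal.span
      {(MvPolynomial.X (Sum.inl 0) * MvPolynomial.X (Sum.inl 1) +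
        MvPolynomial.rename Sum.inr (MvPolynomial.X 0 ^ (n + 1)) : MvPolynomial (Fin 2 ⊕ Fin 1) k)}))) = X.fromSpecStalk s ≫ f) :
    ∃ (V : X.Opens), s ∈ V ∧ (∀ t : X, t ∉ Scheme.regularLocus X → t ∈ V → t = s) ∧
      ∃ (Y : Scheme.{0}) (ρ : Y ⟶ V), IsProper ρ ∧ Scheme.IsRegular Y ∧
        IsIso (ρ ∣_ (V.ι ⁻¹ᵁ ⟨Scheme.regularLocus X, isOpen_regularLocus_of_locallyOfFiniteType_field f⟩)) ∧
        Dense ((ρ ⁻¹ᵁ (V.ι ⁻¹ᵁ ⟨Scheme.regularLocus X,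
          isOpen_regularLocus_of_locallyOfFiniteType_field f⟩) : Y.Opens) : Set Y) := by
  -- `A_n` is an integral `k`-scheme of finite type
  haveI : IsDomain (CommRingCat.of RA[n]) := An_isDomain k n
  haveI : LocallyOfFiniteType (Spec.map (CommRingCat.ofHom (algebraMap k RA[n]))) :=
    An_locallyOfFiniteType k n
  -- Zariski-local recognition: an `A_n` chart at `s`
  obtain ⟨U, hsU, j, hj, hjs, -⟩ := exists_isOpenImmersion_nhd_of_stalk_iso k X
    (Spec (CommRingCat.of RA[n])) f (Spec.map (CommRingCat.ofHom (algebraMap k RA[n]))) s q e he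
  haveI := hj
  -- `n ≥ 1`: otherwise `s` would be a regular point
  have hn : 1 ≤ n := by
    rcases Nat.eq_zero_or_pos n with h0 | hpos
    · subst h0
      haveI : IsRegularLocalRing ((Spec (CommRingCat.of RA[0])).presheaf.stalk q) :=
        An_zero_isRegular k q
      exact absurd (show IsRegularLocalRing (X.presheaf.stalk s) from
        IsRegularLocalRing.of_ringEquiv e.commRingCatIsoToRingEquiv) hs
    · exact hpos
  -- the regular loci correspond under `j`
  have hReg : IsOpen (Scheme.regularLocus (Spec (CommRingCat.of RA[n]))) :=
    isOpen_regularLocus_of_locallyOfFiniteType_field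
      (Spec.map (CommRingCat.ofHom (algebraMap k RA[n])))
  have hD : ((PrimeSpectrum.basicOpen (mkA[n] (MvPolynomial.X (Sum.inl 0))) ⊔
      PrimeSpectrum.basicOpen (mkA[n] (MvPolynomial.X (Sum.inl 1))) ⊔
      PrimeSpectrum.basicOpen (mkA[n] (MvPolynomial.X (Sum.inr 0)))) : (Spec (CommRingCat.of RA[n])).Opens) =
      ⟨Scheme.regularLocus (Spec (CommRingCat.of RA[n])), hReg⟩ := by
    apply le_antisymm
    · intro r hr
      show r ∈ Scheme.regularLocus (Spec (CommRingCat.of RA[n]))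
      rw [An_mem_regularLocus_iff k n hn r]
      rcases hr with (hr | hr) | hr
      · exact Or.inl hr
      · exact Or.inr (Or.inl hr)
      · exact Or.inr (Or.inr hr)
    · intro r hr
      have hr' : r ∈ Scheme.regularLocus (Spec (CommRingCat.of RA[n])) := hr
      rw [An_mem_regularLocus_iff k n hn r] at hr'
      rcases hr' with hr | hr | hr
      · exact Or.inl (Or.inl hr)
      · exact Or.inl (Or.inr hr)
      · exact Or.inr hr
  have hpre := preimage_regularLocus_of_isOpenImmersion U j
    (isOpen_regularLocus_of_locallyOfFiniteType_field f) hReg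
  have huniq : ∀ t : X, t ∉ Scheme.regularLocus X → t ∈ U → t = s := by
    intro t ht htU
    have hjt : j ⟨t, htU⟩ ∉ Scheme.regularLocus (Spec (CommRingCat.of RA[n])) := by
      intro hreg
      have hmem : (⟨t, htU⟩ : U) ∈ j ⁻¹ᵁ ⟨Scheme.regularLocus (Spec (CommRingCat.of RA[n])), hReg⟩ :=
        hreg
      rw [hpre] at hmem
      exact ht hmem
    have hjs' : j ⟨s, hsU⟩ ∉ Scheme.regularLocus (Spec (CommRingCat.of RA[n])) := by
      intro hreg
      have hmem : (⟨s, hsU⟩ : U) ∈ j ⁻¹ᵁ ⟨Scheme.regularLocus (Spec (CommRingCat.of RA[n])), hReg⟩ :=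
        hreg
      rw [hpre] at hmem
      exact hs hmem
    rw [An_mem_regularLocus_iff k n hn] at hjt hjs'
    push_cast [not_or, not_not] at hjt hjs'
    have heq : j ⟨t, htU⟩ = j ⟨s, hsU⟩ := An_point_eq_of_X_mem k n _ _ hjt hjs'
    have hinj := hj.base_open.injective heq
    exact congrArg Subtype.val hinj
  -- the local resolution: restrict the global tower model of `A_n` along the chart `j`
  obtain ⟨Y, ρ, hρ, hY, hiso, hd⟩ := stub_offLocus_resolution_restrict _ _ j _
    (An_offOrigin_resolution k n)
  rw [hD, hpre] at hiso hd
  exact ⟨U, hsU, huniq, Y, ρ, hρ, hY, hiso, hd⟩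

end Summit.ResolutionOfSingularities.ResolutionOfSingularities.Theorems.FRationalResolution

end
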